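import Mathlib.Topology.Order.IntermediateValue
import Mathlib.Topology.Algebra.Order.Field
import Mathlib.Topology.Order.LeftRight
import Mathlib.Analysis.SpecificLimits.Basic
import HarnessLib

/-!
# Half-line curves with a limit at infinity are compact curves

A small reparametrisation tool used by boundary theorems for conformal maps onto complements of
curves running off to infinity (`Literature.Probability.RandomPlanarGeometry.ArmComplementBoundary`):
if `f` is continuous on `[a, ∞)` with `f t → L` as `t → +∞`, then `insert L (f '' [a, ∞))` is the
image of the compact interval `[0, 1]` under a map continuous on `[0, 1]` — reparametrise by
`u ↦ a + u/(1-u)` and send `1 ↦ L` (`exists_continuousOn_Icc_of_tendsto_atTop`). Consequently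
such a "curve closed up at infinity" is compact and connected (`isCompact_insert_image_Ici`,
`isPreconnected_insert_image_Ici`), and every tool for continuous images of compact intervals
(e.g. `Literature.Topology.PlaneTopology.IsUniformlyLocallyConnected.of_image_Icc`) applies to it.
Elementary; no source is followed.
-/

noncomputable section

open Set Filter Topology

namespace Literature.Topology.PlaneTopology

/-! ### Half-line curves with a limit at infinity are compact curves -/

/-- The reparametrisation `u ↦ a + u / (1 - u)` maps `[0, 1)` onto `[a, ∞)`. [folklore] -/
theorem image_halfLineParam_Ico (a : ℝ) :
    (fun u : ℝ ↦ a + u / (1 - u)) '' Ico 0 1 = Ici a := by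
  ext t
  constructor
  · rintro ⟨u, ⟨hu0, hu1⟩, rfl⟩
    exact le_add_of_nonneg_right (div_nonneg hu0 (by linarith))
  · intro ht
    have hs : 0 ≤ t - a := sub_nonneg.2 ht
    refine ⟨(t - a) / (1 + (t - a)), ⟨div_nonneg hs (by linarith), ?_⟩, ?_⟩
    · rw [div_lt_one (by linarith)]
      linarith
    · have h1 : (1 : ℝ) + (t - a) ≠ 0 := by linarith
      field_simp
      ring

/-- **A half-line curve with a limit at `+∞` is a compact curve.** If `f` is continuous on
`[a, ∞)` and `f t → L` as `t → +∞`, there is `c`, continuous on `[0, 1]`, with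
`c '' [0, 1] = insert L (f '' [a, ∞))`, `c 0 = f a`, `c 1 = L` (namely `c u = f (a + u/(1-u))`
for `u < 1`). [folklore] -/
theorem exists_continuousOn_Icc_of_tendsto_atTop {X : Type*} [TopologicalSpace X] {f : ℝ → X}
    {a : ℝ} {L : X} (hf : ContinuousOn f (Ici a)) (hL : Tendsto f atTop (𝓝 L)) :
    ∃ c : ℝ → X, ContinuousOn c (Icc 0 1) ∧ c '' Icc 0 1 = insert L (f '' Ici a) ∧
      c 0 = f a ∧ c 1 = L := by
  classical
  set ρ : ℝ → ℝ := fun u ↦ a + u / (1 - u) with hρ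
  set c : ℝ → X := fun u ↦ if u < 1 then f (ρ u) else L with hc
  have hρmaps : MapsTo ρ (Icc 0 1) (Ici a) := by
    intro u hu
    rcases lt_or_eq_of_le hu.2 with hu1 | rfl
    · exact le_add_of_nonneg_right (div_nonneg hu.1 (by linarith))
    · simp [hρ]
  have hc_eq : ∀ u, u < 1 → c u = f (ρ u) := fun u hu ↦ by simp [hc, hu]
  have hc1 : c 1 = L := by simp [hc]
  -- the limit at `u → 1⁻`
  have hρtop : Tendsto ρ (𝓝[<] 1) atTop := by
    have h1 : Tendsto (fun u : ℝ ↦ 1 - u) (𝓝[<] 1) (𝓝[>] 0) := by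
      refine tendsto_nhdsWithin_iff.2 ⟨?_, ?_⟩
      · have : Tendsto (fun u : ℝ ↦ 1 - u) (𝓝 1) (𝓝 (1 - 1)) :=
          tendsto_const_nhds.sub tendsto_id
        rw [sub_self] at this
        exact this.mono_left nhdsWithin_le_nhds
      · filter_upwards [self_mem_nhdsWithin] with u hu
        exact sub_pos.2 (mem_Iio.1 hu)
    have h2 : Tendsto (fun u : ℝ ↦ (1 - u)⁻¹) (𝓝[<] 1) atTop := tendsto_inv_nhdsGT_zero.comp h1
    have h3 : Tendsto (fun u : ℝ ↦ u) (𝓝[<] (1 : ℝ)) (𝓝 1) :=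
      tendsto_id.mono_left nhdsWithin_le_nhds
    have h4 : Tendsto (fun u : ℝ ↦ u * (1 - u)⁻¹) (𝓝[<] 1) atTop := h3.pos_mul_atTop one_pos h2
    have h5 : Tendsto (fun u : ℝ ↦ a + u * (1 - u)⁻¹) (𝓝[<] 1) atTop := tendsto_atTop_add_const_left _ _ h4
    refine h5.congr fun u ↦ ?_
    simp [hρ, div_eq_mul_inv]
  refine ⟨c, ?_, ?_, by simp [hc, hρ], hc1⟩
  · intro u hu
    rcases lt_or_eq_of_le hu.2 with hu1 | rfl
    · have hρc : ContinuousAt ρ u :=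
        continuousAt_const.add (continuousAt_id.div (continuousAt_const.sub continuousAt_id)
          (sub_pos.2 hu1).ne')
      have h2 : ContinuousWithinAt (f ∘ ρ) (Icc 0 1) u :=
        (hf _ (hρmaps hu)).comp hρc.continuousWithinAt hρmaps
      refine h2.congr_of_eventuallyEq ?_ (by rw [Function.comp_apply, hc_eq u hu1])
      have : ∀ᶠ v in 𝓝[Icc 0 1] u, v < 1 :=
        mem_nhdsWithin_of_mem_nhds ((isOpen_gt' (1 : ℝ)).mem_nhds hu1)
      filter_upwards [this] with v hv
      rw [hc_eq v hv, Function.comp_apply]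
    · -- continuity at `1` within `[0, 1]`
      have hleft : ContinuousWithinAt c (Iio 1) 1 := by
        change Tendsto c (𝓝[<] 1) (𝓝 (c 1))
        rw [hc1]
        refine (hL.comp hρtop).congr' ?_
        filter_upwards [self_mem_nhdsWithin] with u hu
        rw [Function.comp_apply, hc_eq u hu]
      have hIic : ContinuousWithinAt c (Iic 1) 1 := continuousWithinAt_Iio_iff_Iic.1 hleft
      exact hIic.mono Icc_subset_Iic_self
  · apply Subset.antisymm
    · rintro _ ⟨u, hu, rfl⟩
      rcases lt_or_eq_of_le hu.2 with hu1 | rfl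
      · rw [hc_eq u hu1]
        exact Or.inr ⟨ρ u, hρmaps hu, rfl⟩
      · exact Or.inl hc1
    · rintro x (rfl | ⟨t, ht, rfl⟩)
      · exact ⟨1, ⟨zero_le_one, le_rfl⟩, hc1⟩
      · have : t ∈ (fun u : ℝ ↦ a + u / (1 - u)) '' Ico 0 1 := by
          rw [image_halfLineParam_Ico]; exact ht
        obtain ⟨u, hu, hut⟩ := this
        refine ⟨u, Ico_subset_Icc_self hu, ?_⟩
        rw [hc_eq u hu.2]
        exact congrArg f hut

/-- A half-line curve with a limit at `+∞`, together with its limit, is compact. [folklore] -/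
theorem isCompact_insert_image_Ici {X : Type*} [TopologicalSpace X] {f : ℝ → X} {a : ℝ} {L : X}
    (hf : ContinuousOn f (Ici a)) (hL : Tendsto f atTop (𝓝 L)) :
    IsCompact (insert L (f '' Ici a)) := by
  obtain ⟨c, hc, himg, -, -⟩ := exists_continuousOn_Icc_of_tendsto_atTop hf hL
  rw [← himg]
  exact isCompact_Icc.image_of_continuousOn hc

/-- A half-line curve with a limit at `+∞`, together with its limit, is preconnected. [folklore] -/
theorem isPreconnected_insert_image_Ici {X : Type*} [TopologicalSpace X] {f : ℝ → X} {a : ℝ}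
    {L : X} (hf : ContinuousOn f (Ici a)) (hL : Tendsto f atTop (𝓝 L)) :
    IsPreconnected (insert L (f '' Ici a)) := by
  obtain ⟨c, hc, himg, -, -⟩ := exists_continuousOn_Icc_of_tendsto_atTop hf hL
  rw [← himg]
  exact isPreconnected_Icc.image _ hc

end Literature.Topology.PlaneTopology
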